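import Summits.BirchSwinnertonDyer.BirchSwinnertonDyer.Theorems.AdditiveBranchIMCTameExactControlReduction
import Summits.BirchSwinnertonDyer.BirchSwinnertonDyer.Theorems.PrintCf2RubinValueTwoTowerLift
import Literature.NumberTheory.EllipticCurves.SelmerCorankAssembly
import HarnessLib

/-!
# AC-LINE SPECIALISATION₂, part (C): CONTROL PROPER `X_Gr₂ ⧸ T₁ → 𝔛_ac` up to `p^m` WITHOUT `E(K)[p] = 0`, from
# ONE LOCAL FINITE-EXPONENT hypothesis at `v̄` — «`E[p^∞]^{Gal(K̄/K̃_∞) ∩ I_{v̄}}` is killed by `p^c`»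
# (crux `BDPSelmerLowerDivisibilityAtTwo`, stmt-BirchSwinnertonDyer-24728; route `TwoAdicConverse`, S3)

Helper file `--supports stmt-BirchSwinnertonDyer-24728` (cell `bsd-2adic`, seat `bsd-2adic-tower-1` GEN 53; key
«AC-LINE SPECIALISATION₂» (S3) = director-bsd (642)(1), pen SUMMON 20260830T184646Z). THEOREMS ONLY (no definition,
no named fact, no instance, no `sorry`).

THE HINGE OF THE DOOR. The specialisation of part (A) (`TwoAdicBDPAcLineSpec.charIdeal_XAc_map_le_rat'`) reads the
control map `X_Gr₂ ⧸ T₁X_Gr₂ → 𝔛_ac` through ONE input, `hctl`: «there is `m` such that every `conj_{γ₁}`-fixed class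
`s` of `H¹_{nr,v̄}(K̃_∞, E[p^∞]) = unrSelmer₂ κ₁ κ₂ E[p^∞] v̄` has `p^m · s ∈ range (selmerAcToUnrSelmer₂)`». The additive
family's `TameExactControl.exists_pow_smul_mem_range_selmerAcToUnrSelmer₂` (l.198) proves `hctl` from `hK : E(K)[p] = 0`
(GLOBAL lift, via `E[p^∞]^{Gal(K̄/K̃_∞)} = 0`) and the local VANISHING `hfix : E[p^∞]^{Gal(K̄/K̃_∞) ∩ I_{v̄}} = 0`. On the
habitat (β) at `p = 2` BOTH fail (`E(ℚ)[2] ≠ 0`; and `Ê[2]` is fixed by `Gal(K̄/K̃_∞) ∩ I_{v̄}`, whose cyclotomic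
character has image `{±1}`). This file proves `hctl` at ANY `p`, for ANY `W` elliptic over a number field all of whose
infinite places are complex, from the ONE typed LOCAL hypothesis, stated in `TameExactControl`'s own currency WITH AN
EXPONENT:

  `hfixc : ∃ c, ∀ m : E[p^∞], (∀ x ∈ pairKer κ₁ κ₂, x ∈ inertia v̄ → x • m = m) → p^c • m = 0`

(«`E[p^∞]^{Gal(K̄/K̃_∞) ∩ I_{v̄}}` has finite exponent»; `hfix` is its case `c = 0`, `hfixc_of_hfix`).

* §1 `nsmul_eq_zero_of_resOfLe_eq_zero` — generic INFLATION–RESTRICTION WITH EXPONENT (`H' ≤ H` subgroups of a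
  topological group `G`, `H' ⊴ G`, `M` discrete): if `M^{H'}` is killed by `n`, then `ker(res : H¹(H, M) → H¹(H', M))`
  is killed by `n` — the tree's `resOfLe_injective_of_forall_fixed_eq_zero` (`TwoVariableAnticyclotomicControl` §3) is
  the case `n = 1`; same cocycle computation (`z(h) − (h•a − a) ∈ M^{H'}` for `z|_{H'} = δa`).
* §2 `nsmul_mem_strictKer_of_resOfLe_mem_greenbergKer` (+ `…_strictDatum`) — the exponent form of `TameExactControl`
  §2: if `(M/M⁺_v)^{H ∩ I_v}` is killed by `n`, then «`res y` Greenberg at `v` over `K̄^H`» ⟹ «`n • y` STRICT at `v`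
  over `K̄^{H'}`».
* §3 ★ `exists_pow_smul_mem_range_selmerAcToUnrSelmer₂_of_exponent` — `hctl` from `hfixc` alone: GLOBAL by the
  tree's `hK`-FREE tower lift `ZpExtension.mem_range_resOfLe_pairKer_right_of_conjH1_eq` (cf2c-w8 p684615,
  `PrintCf2RubinValueTwoTowerLift`: Greenberg's Lemma 3.2 `H²(ℤ_p, M^{Gal(K̄/K̃_∞)}) = 0` by cocycle extension, NO
  fixed-point hypothesis; orbits of `E[p^∞]` continuous, `E[p^∞]` `p`-primary); AWAY from `p` verbatim
  (`TameExactControl.mem_unramifiedKer_of_resOfLe_mem`, `I_v ≤ ker κ₁`, sbc-p1's integer `t`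
  `SignedBaseChangeAcDivAwayDiscrepancy.exists_nsmul_mem_selmerAc_of_mem_datumStrictSelmer`); AT `v̄` by §2 on `p^c • y`;
  Bézout (`TameExactControl.exists_pow_smul_mem_of_nsmul_mem`) on the `p`-primary class with the integer `t · p^c`.
* §4 `acLineControl_of_localExponent` — the `ℚ`-curve form (`W.baseChange K`, `K` imaginary quadratic) = the binder
  `hctl` of part (A)/(B) at `(W.baseChange K, p, κ₁, κ₂, v̄, γ₁)` ⟸ `hfixc`.

WHAT IS NOT HERE (the missing LOCAL object, decl-shaped): the DISCHARGE of `hfixc` on (β) at `2` — «for `E/ℚ` non-CM,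
good ordinary at `2`, `K` imaginary quadratic with `2 = v v̄`, any generator pair: `E[2^∞]^{Gal(K̄/K̃_∞) ∩ I_{v̄}}` is
finite» (the fixed field of `Gal(K̄/K̃_∞) ∩ I_{v̄}` at `v̄` is `ℚ₂^{nr}·ℚ_{2,∞}`; finiteness = non-splitting of
`0 → Ê[2^∞] → E[2^∞] → Ẽ[2^∞] → 0` over it, Serre–Tate; `c ≥ 1` always since `Ê[2]` is fixed). HONEST LABELS:
Galois-cohomological bookkeeping on CONSTRUCTED carriers; closes nothing; the count of record of O2 does not move; BSD is
proved for no curve by any of this; typed ≠ proved. References: Skinner–Urban, Invent. Math. 195 (2014) §3.2.7–3.2.8;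
Jetchev–Skinner–Wan, Camb. J. Math. 5 (2017) §3.4; Greenberg, LNM 1716 (1999) §3 Lemmas 3.1–3.3; Serre, *Local
Fields* VII §6 Prop. 4; Agboola, §3 Prop. 3.2.
-/

-- D-0017: single-problem summit, the namespace repeats the problem name by design.
set_option linter.dupNamespace false
set_option autoImplicit false

noncomputable section

open scoped Classical

open NumberField IsDedekindDomain Field
open Literature.NumberTheory.EllipticCurves Literature.NumberTheory.GaloisRepresentations
  Literature.NumberTheory.EllipticCurves.GreenbergSelmer Literature.NumberTheory.EllipticCurves.GreenbergVatsal2000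
  Literature.NumberTheory.EllipticCurves.Castella2018
open Summit.BirchSwinnertonDyer.BirchSwinnertonDyer.Theorems.TameExactControl

namespace Summit.BirchSwinnertonDyer.BirchSwinnertonDyer.Theorems.TwoAdicBDPAcLineSpec

/-! ## §1. Inflation–restriction WITH EXPONENT: `M^{H'}` killed by `n` ⟹ `ker(res : H¹(H) → H¹(H'))` killed by `n` -/

section InfRes

universe u

variable {G : Type u} [Group G] [TopologicalSpace G] [IsTopologicalGroup G]
  {M : Type u} [AddCommGroup M] [DistribMulAction G M] [TopologicalSpace M] [DiscreteTopology M]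

/-- **Inflation–restriction with exponent.** For subgroups `H' ≤ H` of a topological group `G` with `H'` normal in
`G`, and a discrete `G`-module `M` whose `H'`-fixed points are KILLED BY `n`, every class `c ∈ H¹(H, M)` with
`res c = 0` in `H¹(H', M)` has `n • c = 0`. On cocycles: if `z|_{H'} = δa` then for `h ∈ H`, `x ∈ H'`, expanding
`z(xh) = z(h · h⁻¹xh)` both ways gives `x • (z(h) − (h•a − a)) = z(h) − (h•a − a)`, so `z(h) − (h•a − a) ∈ M^{H'}` is
killed by `n` and `n • z = δ(n • a)`. (The kernel of `res` is `H¹(H/H', M^{H'})`, killed by the exponent of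
`M^{H'}`.) The case `n = 1` is the tree's `resOfLe_injective_of_forall_fixed_eq_zero`.
[cite: GreenbergLNM1716, §3 Lemma 3.1 (PDF p. 86)] [cite: SerreLocalFields1979, VII.§6 Prop. 4] -/
theorem nsmul_eq_zero_of_resOfLe_eq_zero {H H' : Subgroup G} [hH' : H'.Normal]
    (hle : H' ≤ H) {n : ℕ} (hfix : ∀ m : M, (∀ x ∈ H', x • m = m) → n • m = 0)
    {c : subgroupH1 H M} (hc : resOfLe M hle c = 0) : n • c = 0 := by
  obtain ⟨z, rfl⟩ := oneCocycleClass_surjective _ c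
  obtain ⟨a, ha⟩ := (CocycleCriteria.resOfLe_oneCocycleClass_eq_zero_iff hle z).mp hc
  rw [← oneCocycleClassₗ_apply, ← map_nsmul, oneCocycleClassₗ_apply, oneCocycleClass_eq_zero_iff]
  refine ⟨n • a, fun h ↦ ?_⟩
  rw [Submodule.coe_smul_of_tower, ContinuousMap.smul_apply]
  change n • z.1 h = (h : G) • (n • a) - n • a
  -- the element `z(h) − (h•a − a)` is `H'`-fixed, hence killed by `n`
  have key : n • (z.1 h - ((h : G) • a - a)) = 0 := by
    refine hfix _ fun x hx ↦ ?_
    -- the two elements of `H` through which we expand the cocycle identity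
    have hy : (h : G)⁻¹ * x * h ∈ H' := by
      simpa only [inv_inv] using hH'.conj_mem x hx (h : G)⁻¹
    set xH : H := ⟨x, hle hx⟩ with hxH
    set yH : H := ⟨(h : G)⁻¹ * x * h, hle hy⟩ with hyH
    have hmul : xH * h = h * yH := Subtype.ext (by
      simp only [hxH, hyH, Subgroup.coe_mul, ← mul_assoc, mul_inv_cancel, one_mul])
    have hzx : z.1 xH = x • a - a := ha ⟨x, hx⟩
    have hzy : z.1 yH = ((h : G)⁻¹ * x * h) • a - a := ha ⟨(h : G)⁻¹ * x * h, hy⟩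
    -- `z(xH · h) = z(xH) + x • z(h)` and `z(h · yH) = z(h) + h • z(yH)`
    have e1 : z.1 (xH * h) = (x • a - a) + x • z.1 h := by
      rw [z.2 xH h, hzx]
      rfl
    have e2 : z.1 (xH * h) = z.1 h + ((x • ((h : G) • a)) - (h : G) • a) := by
      rw [hmul, z.2 h yH, hzy]
      change z.1 h + (h : G) • (((h : G)⁻¹ * x * h) • a - a) = _
      rw [smul_sub, smul_smul, ← mul_assoc, ← mul_assoc, mul_inv_cancel, one_mul, mul_smul]
    have e := eq_sub_of_add_eq' (e1.symm.trans e2)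
    rw [smul_sub, smul_sub, e]
    abel
  rw [smul_sub, sub_eq_zero, smul_sub] at key
  rw [key, smul_comm n (h : G) a]

end InfRes

/-! ## §2. Finite-exponent inertia-fixed points ⟹ Greenberg over `K̄^H` gives `n •` STRICT over `K̄^{H'}` -/

section Strict

variable {K : Type} [Field K] [NumberField K]
  {M : Type} [AddCommGroup M] [DistribMulAction (absoluteGaloisGroup K) M] [TopologicalSpace M]
  [DiscreteTopology M]

/-- **Greenberg over `K̄^H` ⟹ `n •` strict over `K̄^{H'}` when `(M/M⁺_v)^{H ∩ I_v}` is killed by `n`** (`H ≤ H'`,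
`H ⊴ Γ_K`, any local datum `M⁺_v`): if the restriction `res y ∈ H¹(H, M)` of `y ∈ H¹(H', M)` satisfies Greenberg's
inertia condition at `v` and every point of `M/M⁺_v` fixed by `H ∩ I_v` is killed by `n`, then `n • y` satisfies the
STRICT condition at `v`: the kernel of `H¹(H' ∩ D_v, M/M⁺_v) → H¹(H ∩ I_v, M/M⁺_v)` is killed by `n` (§1; `H ∩ I_v ⊴ D_v`,
`SignedEC.SharpEigen.inertiaIn_normal`). The case `n = 1` is `TameExactControl.mem_strictKer_of_resOfLe_mem_greenbergKer`.
[cite: SkinnerUrban2014, Prop. 3.2.8 (p. 23)] [cite: GreenbergLNM1716, §3 Lemma 3.1, Lemma 3.3] [cite: SerreLocalFields1979, VII §6 Prop. 4] -/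
theorem nsmul_mem_strictKer_of_resOfLe_mem_greenbergKer {H H' : Subgroup (absoluteGaloisGroup K)} [H.Normal]
    (hle : H ≤ H') {v : HeightOneSpectrum (𝓞 K)} (N : LocalDatum K M v) {n : ℕ}
    (hfix : ∀ g : N.Gr, (∀ x : decomp (K := K) v, x ∈ inertiaIn H v → x • g = g) → n • g = 0)
    {y : subgroupH1 H' M} (h : resOfLe M hle y ∈ N.greenbergKer H) : n • y ∈ N.strictKer H' := by
  haveI : (inertiaIn H v).Normal := SignedEC.SharpEigen.inertiaIn_normal H v
  have hι : inertiaIn H v ≤ decompIn H' v := (inertiaIn_le_decompIn H v).trans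
    (fun x hx ↦ (mem_decompIn_iff H' v x).2 (hle ((mem_decompIn_iff H v x).1 hx)))
  rw [LocalDatum.mem_strictKer_iff, map_nsmul]
  refine nsmul_eq_zero_of_resOfLe_eq_zero (M := N.Gr) hι hfix ?_
  rw [resOfLe_strictMap_eq_greenbergMap_resOfLe hle N y]
  exact (LocalDatum.mem_greenbergKer_iff H N _).1 h

/-- The case `M⁺_v = 0` (Castella's STRICT datum): if every point of `M` fixed by `H ∩ I_v` is killed by `n`, then
Greenberg's inertia condition for `res y` over `K̄^H` implies the strict condition for `n • y` over `K̄^{H'}`. The case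
`n = 1` is `TameExactControl.mem_strictKer_strictDatum_of_resOfLe_mem_greenbergKer`.
[cite: SkinnerUrban2014, Prop. 3.2.8 (p. 23)] [cite: Castella2018, Def. 2.2 (arXiv:1704.06608 p. 5)] -/
theorem nsmul_mem_strictKer_strictDatum_of_resOfLe_mem_greenbergKer {H H' : Subgroup (absoluteGaloisGroup K)}
    [H.Normal] (hle : H ≤ H') (v : HeightOneSpectrum (𝓞 K)) {n : ℕ}
    (hfix : ∀ m : M, (∀ x : absoluteGaloisGroup K, x ∈ H → x ∈ inertia v → x • m = m) → n • m = 0)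
    {y : subgroupH1 H' M} (h : resOfLe M hle y ∈ (AcSelmer.strictDatum M v).greenbergKer H) :
    n • y ∈ (AcSelmer.strictDatum M v).strictKer H' := by
  refine nsmul_mem_strictKer_of_resOfLe_mem_greenbergKer hle _ (fun g hg ↦ ?_) h
  obtain ⟨m, rfl⟩ := (AcSelmer.strictDatum M v).grMk_surjective g
  have hm : n • m = 0 := by
    refine hfix m fun x hxH hxI ↦ ?_
    have hxD : x ∈ decomp (K := K) v := inertia_le_decomp v hxI
    have h1 := hg ⟨x, hxD⟩ ((mem_inertiaIn_iff H v _).2 ⟨hxH, hxI⟩)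
    rw [LocalDatum.smul_grMk, ← sub_eq_zero, ← map_sub, ← AddMonoidHom.mem_ker, LocalDatum.ker_grMk] at h1
    change x • m - m ∈ (⊥ : AddSubgroup M) at h1
    rw [AddSubgroup.mem_bot, sub_eq_zero] at h1
    exact h1
  rw [← map_nsmul, hm, map_zero]

end Strict

/-! ## §3. The `ℤ_p²`-tower over the anticyclotomic line: control up to `p^m` from the local finite exponent at `v̄`,
WITHOUT `E(K)[p] = 0` -/

section Tower

variable {K : Type} [Field K] [NumberField K] (W : WeierstrassCurve K) [W.IsElliptic] (p : ℕ) [Fact p.Prime]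
  (κ₁ κ₂ : ZpExtension K p) (vbar : HeightOneSpectrum (𝓞 K)) {γ₁ γ₂ : absoluteGaloisGroup K}

omit [W.IsElliptic] in
/-- `hfix ⟹ hfixc`: the local VANISHING `E[p^∞]^{Gal(K̄/K̃_∞) ∩ I_{v̄}} = 0` of `TameExactControl` is the case `c = 0`
of the finite-exponent hypothesis of this file (sanity bridge; so every consumer of the old door is a consumer of the
new one). [folklore] -/
theorem hfixc_of_hfix
    (hfix : ∀ m : W.geomPrimaryTorsion p, (∀ x : absoluteGaloisGroup K,
      x ∈ ZpExtension.pairKer κ₁ κ₂ → x ∈ inertia vbar → x • m = m) → m = 0) :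
    ∃ c : ℕ, ∀ m : W.geomPrimaryTorsion p, (∀ x : absoluteGaloisGroup K,
      x ∈ ZpExtension.pairKer κ₁ κ₂ → x ∈ inertia vbar → x • m = m) → p ^ c • m = 0 :=
  ⟨0, fun m hm ↦ by rw [hfix m hm, smul_zero]⟩

omit [W.IsElliptic] in
/-- **GLOBAL lift, `hK`-FREE** (recorded in this frame): every `conj_{γ₁}`-fixed class `s` of
`H¹_{nr,v̄}(K̃_∞, E[p^∞]) = unrSelmer₂ κ₁ κ₂ E[p^∞] v̄` is `res y` for some `y ∈ H¹(K_∞^{(2)}, E[p^∞]) = H¹(ker κ₂, E[p^∞])`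
— for ANY `W` over a number field, ANY `p`, ANY generator pair, with NO hypothesis on `E(K)[p]`: the tree's tower lift
`ZpExtension.mem_range_resOfLe_pairKer_right_of_conjH1_eq` (Greenberg's Lemma 3.2, `H²(ℤ_p, E(K̃_∞)[p^∞]) = 0`, by
continuous cocycle extension) at `M = E[p^∞]` (continuous orbits `continuous_smul_geomPrimaryTorsion`, `p`-primary
`exists_pow_smul_geomPrimaryTorsion_eq_zero`). Compare sbc-p1's `SignedBaseChangeAcDivControlCoker.exists_resOfLe_eq_of_conjSel₂_eq`,
which needs `hK : E(K)[p] = 0`. [cite: GreenbergLNM1716, §3 Lemma 3.2] [cite: SkinnerUrban2014, Prop. 3.2.8 (p. 23)] -/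
theorem exists_resOfLe_eq_of_conjSel₂_eq_of_pair (hγ : ZpExtension.IsTopGeneratorPair κ₁ κ₂ γ₁ γ₂)
    (s : unrSelmer₂ κ₁ κ₂ (W.geomPrimaryTorsion p) vbar)
    (hs : conjSel₂ κ₁ κ₂ (W.geomPrimaryTorsion p) vbar γ₁ s = s) :
    ∃ y : W.subgroupH1 p κ₂.kerSubgroup,
      W.resOfLe p (ZpExtension.pairKer_le_right κ₁ κ₂) y =
        (s : W.subgroupH1 p (ZpExtension.pairKer κ₁ κ₂)) := by
  have hs' : conjH1 (ZpExtension.pairKer κ₁ κ₂) (W.geomPrimaryTorsion p) γ₁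
      (s : subgroupH1 (ZpExtension.pairKer κ₁ κ₂) (W.geomPrimaryTorsion p)) = s := by
    have h := congrArg (fun t : unrSelmer₂ κ₁ κ₂ (W.geomPrimaryTorsion p) vbar ↦
      (t : subgroupH1 (ZpExtension.pairKer κ₁ κ₂) (W.geomPrimaryTorsion p))) hs
    simpa only [coe_conjSel₂_apply] using h
  exact AddMonoidHom.mem_range.mp (ZpExtension.mem_range_resOfLe_pairKer_right_of_conjH1_eq hγ
    (W.continuous_smul_geomPrimaryTorsion p) (W.exists_pow_smul_geomPrimaryTorsion_eq_zero p) _ hs')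

/-- ★ **CONTROL UP TO `p^m` FROM THE LOCAL FINITE EXPONENT AT `v̄`, WITHOUT `E(K)[p] = 0`.** Let `W` be elliptic over a
number field `K` all of whose infinite places are complex, `(κ₁, κ₂; γ₁, γ₂)` a topological generator pair of
`ℤ_p`-extensions, `v̄ ∋ p`, and suppose every point of `E[p^∞]` fixed by `Gal(K̄/K̃_∞) ∩ I_{v̄}` is killed by `p^c`
(`hfixc`). Then there is `m` such that every `conj_{γ₁}`-fixed class `s` of `H¹_{nr,v̄}(K̃_∞, E[p^∞])`
(`unrSelmer₂ κ₁ κ₂ E[p^∞] v̄`) has `p^m · s` in the range of the restriction from Castella's `Sel_{v̄}^∅(K_∞^{(2)}, E[p^∞])`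
(`selmerAcToUnrSelmer₂`) — the hypothesis `hctl` of the specialisation `TwoAdicBDPAcLineSpec.charIdeal_XAc_map_le_rat'`.
GLOBAL: `s = res y` (`exists_resOfLe_eq_of_conjSel₂_eq_of_pair`, no `hK`); AWAY from `p`: `I_v ≤ ker κ₁` so `conj_σ y` is
unramified where `res (conj_σ y)` is (`TameExactControl.mem_unramifiedKer_of_resOfLe_mem`); AT `v̄`: `p^c • conj_σ y` is
strict (§2); so `p^c • y ∈ datumStrictSelmer`, then `t • p^c • y ∈ Sel_{v̄}^∅(K_∞^{(2)})` for sbc-p1's integer `t`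
(`exists_nsmul_mem_selmerAc_of_mem_datumStrictSelmer`) and Bézout on the `p`-primary class `s`
(`TameExactControl.exists_pow_smul_mem_of_nsmul_mem`, integer `t · p^c`).
[cite: SkinnerUrban2014, §3.2.7 and Prop. 3.2.8 (p. 23)] [cite: JetchevSkinnerWan2017, §3.4 (arXiv:1512.06894 pp. 14–15)]
[cite: GreenbergLNM1716, §3 Lemmas 3.1–3.3] [cite: Agboola2007, §3 Prop. 3.2] -/
theorem exists_pow_smul_mem_range_selmerAcToUnrSelmer₂_of_exponent
    (hγ : ZpExtension.IsTopGeneratorPair κ₁ κ₂ γ₁ γ₂)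
    (hKc : ∀ w : InfinitePlace K, w.IsComplex) (hvbar : ((p : ℕ) : 𝓞 K) ∈ vbar.asIdeal)
    (hfixc : ∃ c : ℕ, ∀ m : W.geomPrimaryTorsion p, (∀ x : absoluteGaloisGroup K,
      x ∈ ZpExtension.pairKer κ₁ κ₂ → x ∈ inertia vbar → x • m = m) → p ^ c • m = 0) :
    ∃ m : ℕ, ∀ s : unrSelmer₂ κ₁ κ₂ (W.geomPrimaryTorsion p) vbar,
      conjSel₂ κ₁ κ₂ (W.geomPrimaryTorsion p) vbar γ₁ s = s →
        p ^ m • s ∈ Set.range (W.selmerAcToUnrSelmer₂ p κ₁ κ₂ vbar) := by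
  have hp : p.Prime := Fact.out
  obtain ⟨c, hc⟩ := hfixc
  obtain ⟨t, ht0, ht⟩ := SignedBaseChangeAcDivAwayDiscrepancy.exists_nsmul_mem_selmerAc_of_mem_datumStrictSelmer
    W p κ₂ hKc hvbar
  have htc0 : t * p ^ c ≠ 0 := mul_ne_zero ht0 (pow_ne_zero c hp.ne_zero)
  refine ⟨(t * p ^ c).factorization p, fun s hs ↦ ?_⟩
  -- GLOBAL: `s = res y`, no hypothesis on `E(K)[p]`
  obtain ⟨y, hy⟩ := exists_resOfLe_eq_of_conjSel₂_eq_of_pair W p κ₁ κ₂ vbar hγ s hs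
  have hle := ZpExtension.pairKer_le_right κ₁ κ₂
  have hcomm : ∀ σ : absoluteGaloisGroup K, conjH1 (ZpExtension.pairKer κ₁ κ₂) (W.geomPrimaryTorsion p) σ
      (resOfLe (W.geomPrimaryTorsion p) hle y) = resOfLe (W.geomPrimaryTorsion p) hle
        (conjH1 κ₂.kerSubgroup (W.geomPrimaryTorsion p) σ y) := fun σ ↦ by
    rw [← AddMonoidHom.comp_apply, ← resOfLe_comp_conjH1_holds (M := W.geomPrimaryTorsion p) hle σ,
      AddMonoidHom.comp_apply]
  have hsmem : resOfLe (W.geomPrimaryTorsion p) hle y ∈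
      datumSelmer (ZpExtension.pairKer κ₁ κ₂) (W.geomPrimaryTorsion p) p
        (AcSelmer.bdpData (W.geomPrimaryTorsion p) p vbar) ∅ := by
    have : W.resOfLe p hle y ∈ unrSelmer₂ κ₁ κ₂ (W.geomPrimaryTorsion p) vbar := by rw [hy]; exact s.2
    exact this
  rw [mem_datumSelmer_iff, mem_unramifiedOutside_iff] at hsmem
  obtain ⟨hunr, hgr⟩ := hsmem
  -- `p^c • y` lies in Greenberg–Vatsal's STRICT group over `K_∞^{(2)}`
  have hyStr : p ^ c • y ∈ datumStrictSelmer κ₂.kerSubgroup (W.geomPrimaryTorsion p) p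
      (AcSelmer.bdpData (W.geomPrimaryTorsion p) p vbar) ∅ := by
    rw [mem_datumStrictSelmer_iff, mem_unramifiedOutside_iff]
    refine ⟨fun v _ hpv σ ↦ ?_, fun v hv σ ↦ ?_⟩
    · -- AWAY from `p`: the inertia groups of `K̃_∞` and `K_∞^{(2)}` at `v` agree (`I_v ≤ ker κ₁`)
      have hI : κ₂.kerSubgroup ⊓ inertia v ≤ ZpExtension.pairKer κ₁ κ₂ := by
        have hI1 : inertia v ≤ κ₁.kerSubgroup := by
          have e : inertia v = (adicCompletionPrime K v).inertia (absoluteGaloisGroup K) :=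
            (inertia_adicCompletionPrime_eq_map_absInertia K v).symm
          rw [e]
          exact ZpExtension.inertia_le_kerSubgroup_holds K p κ₁ hpv (adicCompletionPrime_mem_primesAbove K v)
        rintro x ⟨hx2, hxI⟩
        exact ZpExtension.mem_pairKer_iff.2 ⟨ZpExtension.mem_kerSubgroup.1 (hI1 hxI), ZpExtension.mem_kerSubgroup.1 hx2⟩
      rw [map_nsmul]
      refine AddSubgroup.nsmul_mem _ (mem_unramifiedKer_of_resOfLe_mem hle v hI ?_) _
      rw [← hcomm]
      exact hunr v (Set.notMem_empty v) hpv σ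
    · by_cases hvb : v = vbar
      · subst hvb
        rw [AcSelmer.bdpData_self p v hv, map_nsmul]
        refine nsmul_mem_strictKer_strictDatum_of_resOfLe_mem_greenbergKer hle v hc ?_
        rw [← hcomm]
        have h2 := hgr v hv σ
        rwa [AcSelmer.bdpData_self p v hv] at h2
      · rw [AcSelmer.bdpData_of_ne p vbar hv hvb, AcSelmer.strictKer_relaxedDatum_eq_top]
        exact AddSubgroup.mem_top _
  -- `t • p^c • y ∈ Sel_{v̄}^∅(K_∞^{(2)})`, hence `(t · p^c) • s ∈ range(res)`
  have hty : t • (p ^ c • y) ∈ AcSelmer.selmerAc W p κ₂ vbar ∅ := ht _ hyStr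
  have hts : (t * p ^ c) • s ∈ Set.range (W.selmerAcToUnrSelmer₂ p κ₁ κ₂ vbar) := by
    refine ⟨⟨t • (p ^ c • y), hty⟩, Subtype.ext ?_⟩
    rw [WeierstrassCurve.coe_selmerAcToUnrSelmer₂_apply, AddSubgroup.coe_nsmul, map_nsmul, map_nsmul, hy,
      mul_smul]
  -- `s` is `p`-primary
  obtain ⟨k, hk⟩ : ∃ k : ℕ, p ^ k • s = 0 := by
    obtain ⟨k, hk⟩ := TwoVariableSelmer.exists_pow_smul_subgroupH1_pair_eq_zero κ₁ κ₂ (W.geomPrimaryTorsion p)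
      (W.exists_pow_smul_geomPrimaryTorsion_eq_zero p) (s : W.subgroupH1 p (ZpExtension.pairKer κ₁ κ₂))
    exact ⟨k, Subtype.ext (by rw [AddSubgroupClass.coe_nsmul]; exact hk)⟩
  exact exists_pow_smul_mem_of_nsmul_mem p (W.selmerAcToUnrSelmer₂ p κ₁ κ₂ vbar).range htc0 hk hts

end Tower

/-! ## §4. The `ℚ`-curve form: the binder `hctl` of the specialisation at `(W.baseChange K, p, κ₁, κ₂, v̄, γ₁)` from `hfixc` -/

section Rational

/-- ★ **AC-LINE CONTROL AT A GIVEN PAIR FROM THE LOCAL FINITE EXPONENT** — the `ℚ`-curve form: `W/ℚ` elliptic, ANY prime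
`p` (so `p = 2`), `K` imaginary quadratic (all infinite places complex), `(κ₁, κ₂; γ₁, γ₂)` a topological generator pair
(habitat (β): `κ₂ = κ_ac` in the second slot), `v̄ ∋ p`, and `hfixc`: «`E_K[p^∞]^{Gal(K̄/K̃_∞) ∩ I_{v̄}}` is killed by
`p^c`». Conclusion = the hypothesis `hctl` of `TwoAdicBDPAcLineSpec.charIdeal_XAc_map_le_rat'` /
`TameSpecialization.S2L.*` at that pair — with NO `Surj`, NO `p ≠ 2`, NO `E(K)[p] = 0`. Compare
`TameExactControl.tameExactControl_of_localVanishing` (`p ≠ 2`, `Surj W p`, `hfix`).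
[cite: SkinnerUrban2014, Prop. 3.2.8 (p. 23)] [cite: JetchevSkinnerWan2017, §3.4 (arXiv:1512.06894 pp. 14–15)]
[cite: GreenbergLNM1716, §3 Lemmas 3.1–3.3] -/
theorem acLineControl_of_localExponent (W : WeierstrassCurve ℚ) [W.IsElliptic] (p : ℕ) [Fact p.Prime]
    (K : Type) [Field K] [NumberField K] (hK : IsImaginaryQuadratic K)
    (κ₁ κ₂ : ZpExtension K p) (γ₁ γ₂ : absoluteGaloisGroup K) [hγ : Fact (ZpExtension.IsTopGeneratorPair κ₁ κ₂ γ₁ γ₂)]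
    (vbar : HeightOneSpectrum (𝓞 K)) (hvbar : ((p : ℕ) : 𝓞 K) ∈ vbar.asIdeal)
    (hfixc : ∃ c : ℕ, ∀ m : (W.baseChange K).geomPrimaryTorsion p, (∀ x : absoluteGaloisGroup K,
      x ∈ ZpExtension.pairKer κ₁ κ₂ → x ∈ inertia vbar → x • m = m) → p ^ c • m = 0) :
    ∃ m : ℕ, ∀ s : unrSelmer₂ κ₁ κ₂ ((W.baseChange K).geomPrimaryTorsion p) vbar,
      conjSel₂ κ₁ κ₂ ((W.baseChange K).geomPrimaryTorsion p) vbar γ₁ s = s →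
        p ^ m • s ∈ Set.range ((W.baseChange K).selmerAcToUnrSelmer₂ p κ₁ κ₂ vbar) := by
  haveI hEK : (W.baseChange K).IsElliptic := by rw [WeierstrassCurve.baseChange]; infer_instance
  haveI : IsTotallyComplex K := hK.2
  have hKc : ∀ w : InfinitePlace K, w.IsComplex := fun w ↦ IsTotallyComplex.isComplex w
  exact exists_pow_smul_mem_range_selmerAcToUnrSelmer₂_of_exponent (W.baseChange K) p κ₁ κ₂ vbar hγ.out hKc
    hvbar hfixc

end Rational

end Summit.BirchSwinnertonDyer.BirchSwinnertonDyer.Theorems.TwoAdicBDPAcLineSpec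

end
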